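import Summits.BirchSwinnertonDyer.Rank1Residual.Additive.GordCycLowerBoundClass
import Summits.BirchSwinnertonDyer.Rank1Residual.Additive.ChiBranchLowerInputOdd
import Summits.BirchSwinnertonDyer.Rank1Residual.Additive.ChiBranchConstantTermOdd
import Summits.BirchSwinnertonDyer.Rank1Residual.Additive.X3RankZeroSemistableTwistOdd
import Summits.BirchSwinnertonDyer.Rank1Residual.Additive.GordRankZeroChiBranch
import HarnessLib

/-!
# T-O7 step 2, ODD branch (`p ≡ 3 (mod 4)`): `p`-adic Gross–Zagier on the quadratic (minus) branch of
# the good ordinary twist — typed (`BranchPAdicGrossZagierOddAt`), PROVED in rank 0 (odd Birch + MTT),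
# and the rank-one FACTORISATION `ChiBranchLowerDivisibilityOddAt ∧ BranchPAdicGrossZagierOddAt ⟹
# CycLowerBoundAt` (cell `b2b-bsdres`, team n1011, seat p01, OWNERS row T-O7; sibling of
# `GordBranchPAdicGrossZagier.lean`, the even branch)

HONEST FRAMING (cell `b2b-bsdres`, run/shared/lean/b2b/bsd-rank1-residual/, verbatim in every
file): prove what is provable now; shrink each hard class to its core with data; no claim beyond
stated classes. Research routes; census output = EVIDENCE / conjecture items, never a Literature
fact; RESIDUAL-MAP marks change only by signed lines. §I O7 stays OPEN; X4♯(G-ord) stays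
CONSTRUCTION-SHAPED; nothing is booked; no label changes. COVERAGE (stated first, referee 1
proviso): the DEFECT-2 rows `E = V ⊗ χ_{−p}`, `V = E♭` GOOD ORDINARY at `p ≡ 3 (mod 4)` (odd branch
`ω^{(p−1)/2}`, `p* = −p`, MINUS modular symbols and the imaginary period); the class corollary needs
`p ≥ 7` (`p ≡ 3 (mod 4)` and `p ≥ 5`), `E` non-CM, non-anomalous (A175). `p = 3` needs p16's
`Delbourgo2002.mainTheorem_three` instead of A175 and is left to the (G-ord)@3 sibling
(`GordThreeCycRankOne.lean`) — the rank-one factorisation below itself holds at every `p ≡ 3 (mod 4)`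
incl. `3`. ONE definition (typed input, `@[conjecture]`, nothing asserted — PROVED in rank `0`) and
theorems; no Literature fact minted (the odd Birch formula `entireLFunction_one_eq_of_twist_neg` is a
tree THEOREM — no Pal binder on this branch), no `_holds`.

## What

* `BranchPAdicGrossZagierOddAt W p Dh` (§0): for every good ordinary `V` with `C • V^{(−p)} = W`,
  newform `f`, `ϖ · |Ω⁻(V)| = Ω⁻_f`: `L^{(r)}(E,1)/r! = q·Ω_E·Reg_∞` and
  `ϖ · [T^r] L_p^−(f, α, ω^{(p−1)/2}) · log_p(γ)^r = u·q·Reg_p(E,Dh)`, `u ∈ ℤ_p^×`, `r = rank E(ℚ)`.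
* §1 RANK 0: PROVED (`branchPAdicGrossZagierOddAt_of_analyticRank_eq_zero`): MTT
  `B⁻(0) = α⁻¹·∑(a/p)[a/p]⁻_f` (`constantCoeff_padicLFunctionMinusBranch_half`) and the odd Birch
  formula `L(E,1) = ε·ϖ·∑(a/p)[a/p]⁻_f·Ω_E/(|u(C)|·c_∞)` (`entireLFunction_one_eq_of_twist_neg`) with
  `|u(C)|, c_∞` `p`-adic units (`padicValRat_u_eq_zero_of_twist_pm_p`,
  `padicValRat_numRealComponents_eq_zero`).
* §2 RANK 1: `cycLowerBoundAt_of_chiBranchLowerOdd_of_branchPAdicGrossZagierOdd` — p07's W-level odd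
  branch lower input `ChiBranchLowerDivisibilityOddAt W p` ∧ the typed odd `p`-adic Gross–Zagier ⟹
  p01's `CycLowerBoundAt W p Dh` (`B⁻(0) = 0` in rank one).
* §3 class corollary on X4♯(G-ord) ∩ `I₀*`, `p ≡ 3 (mod 4)`, `p ≥ 5`.

References: [Delbourgo1998] Thm. 1 (d = 2), §2.5; [MazurTateTeitelbaum1986Invent] §I.13–I.14;
[PerrinRiou1987] §1.4 (shape); [Delbourgo2002] Thm. (B); [Miller2011LMS] Def. 1.1.
-/

noncomputable section

open scoped Classical MatrixGroups ModularForm NumberField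

open CongruenceSubgroup WeierstrassCurve NumberField Literature.NumberTheory.EllipticCurves
  Literature.NumberTheory.EllipticCurves.ModularForms
  Literature.NumberTheory.EllipticCurves.Rank1Residual
  Literature.NumberTheory.EllipticCurves.Rank1Residual.Typed
  Literature.NumberTheory.EllipticCurves.Delbourgo2002
  IsDedekindDomain

namespace Summit.BirchSwinnertonDyer.Rank1Residual.Additive

/-! ### §0 The typed analytic input on the odd branch -/

/-- **TYPED INPUT — `p`-adic Gross–Zagier on the quadratic branch at an additive prime of defect 2,
ODD branch (`p ≡ 3 (mod 4)`; nothing asserted).** For `W = E` and a `p`-adic height datum `Dh`: for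
every globally minimal `V` GOOD ORDINARY at `p` with `C • V^{(−p)} = W`, every newform `f` of `V` and
every `ϖ ∈ ℚ` with `ϖ · |Ω⁻(V)| = Ω⁻_f`, writing `B = padicLFunctionMinusBranch f α (p/2)` and
`r = rank_ℤ E(ℚ)`: `L^{(r)}(E,1)/r! = q·Ω_E·Reg_∞(E)` with `q ∈ ℚ`, and
`ϖ · [T^r] B · log_p(γ_cyc)^r = u · q · Reg_p(E, Dh)`, `u ∈ ℤ_p^×`. Rank `0`: a THEOREM (§1).
Rank `1`: OPEN — the tree form of "`p`-adic Gross–Zagier at the additive prime ∘ (MTT-branch =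
Delbourgo = Disegni|_cyc comparison) ∘ Gross–Zagier" on the odd branch (r3 ROUTE-r3 §4 S3; ttrl X4-2).
[cite: Delbourgo1998, Thm. 1 and §2.5 BS-D(p) (ii) (pp. 151–152) (shape only; nothing asserted)]
[cite: PerrinRiou1987, §1.4 (shape only)] [cite: MazurTateTeitelbaum1986Invent, §I.14] -/
@[conjecture] def BranchPAdicGrossZagierOddAt (W : WeierstrassCurve ℚ) [W.IsElliptic] (p : ℕ)
    [Fact p.Prime] (Dh : PAdicHeightData W p) : Prop :=
  ∀ (V : WeierstrassCurve ℚ) [V.IsElliptic] [V.IsGloballyMinimal] {N : ℕ} [NeZero N]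
    {f : CuspForm (Gamma0 N) 2},
    p % 4 = 3 → (∃ C : VariableChange ℚ, C • V.quadraticTwist (-(p : ℚ)) = W) → GoodOrd V p →
    IsNewformOf V f → ∀ (ϖ : ℚ), (ϖ : ℝ) * V.imaginaryPeriodRat = minusPeriod f →
      ∃ (u : ℤ_[p]ˣ) (q : ℚ),
        W.leadingLCoeff = (q : ℂ) * (W.realPeriodRat : ℂ) * (W.regulator : ℂ) ∧
        ((ϖ : ℚ) : ℚ_[p]) *
            PowerSeries.coeff W.mordellWeilRank
              (padicLFunctionMinusBranch f ((unitRoot V p : ℤ_[p]) : ℚ_[p]) (p / 2)) *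
            padicLog p (cyclotomicGenerator p) ^ W.mordellWeilRank =
          ((u : ℤ_[p]) : ℚ_[p]) * (q : ℚ_[p]) * padicRegulator Dh

variable (W : WeierstrassCurve ℚ) [W.IsElliptic] [W.IsGloballyMinimal] (p : ℕ) [hp : Fact p.Prime]

/-- The odd Birch formula with the twist datum packaged: for `C • V^{(−p)} = W` (`V` good ordinary,
`W` additive, `p ≡ 3 (mod 4)`) there are `ε = ±1` and a rational `m` with `ord_p m = 0` (`m = |u(C)|·c_∞`)
such that `L(W,1) = (ε·ϖ·∑(a/p)[a/p]⁻_f / m)·Ω_W`. [cite: MazurTateTeitelbaum1986Invent, §I.8 (Birch's formula, odd twist)]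
[cite: SilvermanAEC2009, VII.1 Prop. 1.3(b)] -/
theorem exists_entireLFunction_one_eq_of_twist_neg_unit (hmod : hasEntireLFunction_rat) (hp4 : p % 4 = 3)
    (V : WeierstrassCurve ℚ) [V.IsElliptic] [V.IsGloballyMinimal]
    (hVW : ∃ C : VariableChange ℚ, C • V.quadraticTwist (-(p : ℚ)) = W) (hord : GoodOrd V p)
    (hadd : Addv W p) {N : ℕ} [NeZero N] {f : CuspForm (Gamma0 N) 2} (hf : IsNewformOf V f)
    (ϖ : ℚ) (hϖ : (ϖ : ℝ) * V.imaginaryPeriodRat = minusPeriod f) :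
    ∃ (ε m : ℚ), (ε = 1 ∨ ε = -1) ∧ m ≠ 0 ∧ padicValRat p m = 0 ∧
      W.entireLFunction 1 =
        ((ε * (ϖ * legendreMinusSymbolSum f p) / m : ℚ) : ℂ) * (W.realPeriodRat : ℂ) := by
  have hp2 : p ≠ 2 := by omega
  obtain ⟨C, hC⟩ := hVW
  obtain ⟨ε, hε, hL⟩ := entireLFunction_one_eq_of_twist_neg p hmod hp4 V W C hC hadd hf ϖ hϖ
  set cinf : ℕ := (W.baseChange ℝ).numRealComponents with hcinf
  have hua0 : |(C.u : ℚ)| ≠ 0 := abs_ne_zero.mpr C.u.ne_zero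
  have hcinf0 : (cinf : ℚ) ≠ 0 := by
    rw [hcinf, numRealComponents]
    split_ifs <;> norm_num
  have hu : padicValRat p (C.u : ℚ) = 0 :=
    padicValRat_u_eq_zero_of_twist_pm_p p hp2 V W (Or.inl hord.1) (d := -(p : ℤ)) (Or.inr rfl) C
      (by push_cast; exact hC)
  have hvua : padicValRat p |(C.u : ℚ)| = 0 := by
    rcases abs_choice (C.u : ℚ) with h | h
    · rw [h, hu]
    · rw [h, padicValRat.neg, hu]
  refine ⟨ε, |(C.u : ℚ)| * (cinf : ℚ), hε, mul_ne_zero hua0 hcinf0, ?_, hL⟩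
  rw [padicValRat.mul hua0 hcinf0, hvua, hcinf, padicValRat_numRealComponents_eq_zero W p hp2, add_zero]

/-! ### §1 Rank 0: the typed input is a THEOREM (odd Birch + MTT) -/

/-- **Rank 0, odd branch: `BranchPAdicGrossZagierOddAt W p Dh` HOLDS for every height datum.**
`ϖ·B⁻(0) = ϖ·α⁻¹·∑(a/p)[a/p]⁻_f` and `L(E,1) = ε·ϖ·∑·Ω_E/m` with `ε = ±1`, `ord_p m = 0`; so the
identity holds with the unit `u = ε·m·α⁻¹`. [cite: MazurTateTeitelbaum1986Invent, §I.14] -/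
theorem branchPAdicGrossZagierOddAt_of_analyticRank_eq_zero (hmod : hasEntireLFunction_rat)
    (hGZK : rank_eq_analyticRank_of_analyticRank_le_one) (hadd : Addv W p) (hr : W.analyticRank = 0)
    (Dh : PAdicHeightData W p) : BranchPAdicGrossZagierOddAt W p Dh := by
  intro V _ _ N _ f hp4 hVW hord hf ϖ hϖ
  have hpP : p.Prime := hp.out
  have hp2 : p ≠ 2 := by omega
  obtain ⟨hmw, -⟩ := hGZK W (by rw [hr]; exact zero_le_one)
  have hmw0 : W.mordellWeilRank = 0 := by rw [hmw, hr]
  haveI : Finite W.toAffine.Point := W.finite_point_of_rank_zero hmw0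
  have hRegp : padicRegulator Dh = 1 := padicRegulator_eq_one_of_finite W p Dh
  have hReg : W.regulator = 1 := W.regulator_eq_one_of_rank_zero hmw0
  have hlead : W.leadingLCoeff = W.entireLFunction 1 := W.leadingLCoeff_eq_of_analyticRank_eq_zero hr
  obtain ⟨ε, m, hε, hm0, hvm, hL⟩ :=
    exists_entireLFunction_one_eq_of_twist_neg_unit W p hmod hp4 V hVW hord hadd hf ϖ hϖ
  have hordin : IsOrdinaryAt V p := ⟨hord.1, hord.2⟩
  have hB0 := constantCoeff_padicLFunctionMinusBranch_half p hp2 V hordin hf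
  -- the unit `α⁻¹`
  have hαunit : IsUnit (unitRoot V p) := (unitRoot_spec_holds V p hordin).2
  have hαinv : (((hαunit.unit⁻¹ : ℤ_[p]ˣ) : ℤ_[p]) : ℚ_[p]) = ((unitRoot V p : ℤ_[p]) : ℚ_[p])⁻¹ := by
    have h2 : ((hαunit.unit⁻¹ : ℤ_[p]ˣ) : ℤ_[p]) * unitRoot V p = 1 := by
      have h1 := hαunit.unit.inv_mul
      rwa [IsUnit.unit_spec] at h1
    have h : (((hαunit.unit⁻¹ : ℤ_[p]ˣ) : ℤ_[p]) : ℚ_[p]) * ((unitRoot V p : ℤ_[p]) : ℚ_[p]) = 1 := by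
      rw [← PadicInt.coe_mul, h2, PadicInt.coe_one]
    exact eq_inv_of_mul_eq_one_left h
  -- the unit `ε·m` (a rational of valuation `0`)
  have hε0 : ε ≠ 0 := by rcases hε with h | h <;> · rw [h]; norm_num
  have hvε : padicValRat p ε = 0 := by
    rcases hε with h | h
    · rw [h, padicValRat.one]
    · rw [h, padicValRat.neg, padicValRat.one]
  have hεm0 : ((ε * m : ℚ) : ℚ_[p]) ≠ 0 := by exact_mod_cast mul_ne_zero hε0 hm0
  have hnorm : ‖((ε * m : ℚ) : ℚ_[p])‖ = 1 := by
    rw [Padic.norm_eq_zpow_neg_valuation hεm0, Padic.valuation_ratCast, padicValRat.mul hε0 hm0, hvε,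
      hvm, add_zero, neg_zero, zpow_zero]
  obtain ⟨w, hw⟩ := exists_unit_coe_eq_of_norm_eq_one p hnorm
  refine ⟨w * hαunit.unit⁻¹, ε * (ϖ * legendreMinusSymbolSum f p) / m, ?_, ?_⟩
  · rw [hlead, hL, hReg]
    push_cast
    ring
  · rw [hmw0, pow_zero, mul_one, PowerSeries.coeff_zero_eq_constantCoeff, hB0, hRegp, mul_one,
      Units.val_mul, PadicInt.coe_mul, hw, hαinv]
    have hmQ : ((m : ℚ) : ℚ_[p]) ≠ 0 := by exact_mod_cast hm0
    have hα0 : ((unitRoot V p : ℤ_[p]) : ℚ_[p]) ≠ 0 := fun h ↦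
      hαunit.ne_zero (PadicInt.coe_eq_zero.mp h)
    rcases hε with rfl | rfl <;>
    · push_cast
      field_simp

/-! ### §2 Rank 1: the factorisation on the odd branch -/

/-- **In analytic rank one the odd branch series vanishes at `T = 0`**: `B⁻(0) = α⁻¹·∑(a/p)[a/p]⁻_f`
and `L(E,1) = ε·ϖ·∑·Ω_E/m = 0` with `ε, ϖ, m ≠ 0`, so `∑ = 0`. [cite: MazurTateTeitelbaum1986Invent, §I.14] -/
theorem constantCoeff_minusBranch_eq_zero_of_analyticRank_eq_one (hmod : hasEntireLFunction_rat)
    (hadd : Addv W p) (hr : W.analyticRank = 1) (hp4 : p % 4 = 3)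
    (V : WeierstrassCurve ℚ) [V.IsElliptic] [V.IsGloballyMinimal]
    (hVW : ∃ C : VariableChange ℚ, C • V.quadraticTwist (-(p : ℚ)) = W) (hord : GoodOrd V p)
    {N : ℕ} [NeZero N] {f : CuspForm (Gamma0 N) 2} (hf : IsNewformOf V f)
    (ϖ : ℚ) (hϖ : (ϖ : ℝ) * V.imaginaryPeriodRat = minusPeriod f) :
    PowerSeries.constantCoeff (padicLFunctionMinusBranch f ((unitRoot V p : ℤ_[p]) : ℚ_[p]) (p / 2)) =
      0 := by
  have hp2 : p ≠ 2 := by omega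
  have hordin : IsOrdinaryAt V p := ⟨hord.1, hord.2⟩
  obtain ⟨ε, m, hε, hm0, -, hL⟩ :=
    exists_entireLFunction_one_eq_of_twist_neg_unit W p hmod hp4 V hVW hord hadd hf ϖ hϖ
  have hL0 : W.entireLFunction 1 = 0 := entireLFunction_one_eq_zero_of_analyticRank_eq_one hr
  have hΩ : (W.realPeriodRat : ℂ) ≠ 0 := by exact_mod_cast W.realPeriodRat_pos_holds.ne'
  have hϖ0 : ϖ ≠ 0 := by
    rintro rfl
    have hper : 0 < minusPeriod f := IsNewform0.minusPeriod_pos_holds hf.1 hf.coeffField_eq_bot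
    rw [← hϖ, Rat.cast_zero, zero_mul] at hper
    exact lt_irrefl _ hper
  have hε0 : ε ≠ 0 := by rcases hε with h | h <;> · rw [h]; norm_num
  have hS : legendreMinusSymbolSum f p = 0 := by
    rw [hL0] at hL
    have h := (mul_eq_zero.mp hL.symm).resolve_right hΩ
    have h' : (ε * (ϖ * legendreMinusSymbolSum f p) / m : ℚ) = 0 := by exact_mod_cast h
    simpa [hε0, hϖ0, hm0] using h'
  rw [constantCoeff_padicLFunctionMinusBranch_half p hp2 V hordin hf, hS, Rat.cast_zero, mul_zero]

/-- **RANK ONE, odd branch: the FACTORISATION.** For `W` globally minimal, additive at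
`p ≡ 3 (mod 4)`, of analytic rank `1`, and an admissible `(V, C, f, ϖ)` (`V` good ordinary,
`C • V^{(−p)} = W`, `ϖ·|Ω⁻(V)| = Ω⁻_f`): p07's W-level odd branch lower input
`ChiBranchLowerDivisibilityOddAt W p` and the typed `BranchPAdicGrossZagierOddAt W p Dh` give
`CycLowerBoundAt W p Dh` (`[T¹]fE = h(0)·ϖ·[T¹]B⁻` since `B⁻(0) = 0`). Binders: modularity (`hmod`),
GZK (`hGZK`). [cite: MazurTateTeitelbaum1986Invent, §I.14] [cite: Delbourgo1998, §2.5 (p. 151) (shape)] -/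
theorem cycLowerBoundAt_of_chiBranchLowerOdd_of_branchPAdicGrossZagierOdd
    (hmod : hasEntireLFunction_rat) (hGZK : rank_eq_analyticRank_of_analyticRank_le_one)
    (hadd : Addv W p) (hr : W.analyticRank = 1) (hp4 : p % 4 = 3)
    (V : WeierstrassCurve ℚ) [V.IsElliptic] [V.IsGloballyMinimal]
    (hVW : ∃ C : VariableChange ℚ, C • V.quadraticTwist (-(p : ℚ)) = W) (hord : GoodOrd V p)
    {N : ℕ} [NeZero N] {f : CuspForm (Gamma0 N) 2} (hf : IsNewformOf V f)
    (ϖ : ℚ) (hϖ : (ϖ : ℝ) * V.imaginaryPeriodRat = minusPeriod f)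
    {Dh : PAdicHeightData W p} (hdiv : ChiBranchLowerDivisibilityOddAt W p)
    (hGZ : BranchPAdicGrossZagierOddAt W p Dh) : CycLowerBoundAt W p Dh := by
  intro κ γ hκ hγ hγ' D fE hchar
  have hmw : W.mordellWeilRank = 1 := by rw [(hGZK W (by rw [hr])).1, hr]
  set B := padicLFunctionMinusBranch f ((unitRoot V p : ℤ_[p]) : ℚ_[p]) (p / 2) with hB_def
  have hmem : fE ∈ D.charIdeal := by rw [hchar]; exact Ideal.mem_span_singleton_self fE
  obtain ⟨h, hfac⟩ := hdiv V hp4 hVW hord hκ hγ hγ' hf D ϖ hϖ fE hmem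
  obtain ⟨u, q, hlead, hpgz⟩ := hGZ V hp4 hVW hord hf ϖ hϖ
  rw [hmw, pow_one] at hpgz
  have hB0 : PowerSeries.constantCoeff B = 0 :=
    constantCoeff_minusBranch_eq_zero_of_analyticRank_eq_one W p hmod hadd hr hp4 V hVW hord hf ϖ hϖ
  have hcoeff : ((PowerSeries.coeff 1 fE : ℤ_[p]) : ℚ_[p]) =
      ((PowerSeries.constantCoeff h : ℤ_[p]) : ℚ_[p]) * (((ϖ : ℚ) : ℚ_[p]) * PowerSeries.coeff 1 B) := by
    have hprod : PowerSeries.coeff 1 (iwasawaToPowerSeries p h * (PowerSeries.C ((ϖ : ℚ) : ℚ_[p]) * B)) =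
        PowerSeries.constantCoeff (iwasawaToPowerSeries p h) *
          PowerSeries.coeff 1 (PowerSeries.C ((ϖ : ℚ) : ℚ_[p]) * B) := by
      rw [PowerSeries.coeff_mul, Finset.Nat.antidiagonal_succ, Finset.sum_cons,
        Finset.Nat.antidiagonal_zero]
      simp [hB0, constantCoeff_iwasawaToPowerSeries]
    rw [← Wuthrich2014.coeff_iwasawaToPowerSeries p fE 1, hfac, hprod,
      constantCoeff_iwasawaToPowerSeries, PowerSeries.coeff_C_mul]
  refine ⟨q, PowerSeries.constantCoeff h * (u : ℤ_[p]), hlead, ?_⟩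
  rw [hmw, pow_one, hcoeff]
  push_cast
  calc ((PowerSeries.constantCoeff h : ℤ_[p]) : ℚ_[p]) * (((ϖ : ℚ) : ℚ_[p]) * PowerSeries.coeff 1 B) *
        padicLog p (cyclotomicGenerator p)
      = ((PowerSeries.constantCoeff h : ℤ_[p]) : ℚ_[p]) *
          ((((ϖ : ℚ) : ℚ_[p]) * PowerSeries.coeff 1 B) * padicLog p (cyclotomicGenerator p)) := by ring
    _ = ((PowerSeries.constantCoeff h : ℤ_[p]) : ℚ_[p]) *
          (((u : ℤ_[p]) : ℚ_[p]) * (q : ℚ_[p]) * padicRegulator Dh) := by rw [hpgz]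
    _ = ((PowerSeries.constantCoeff h : ℤ_[p]) : ℚ_[p]) * ((u : ℤ_[p]) : ℚ_[p]) * (q : ℚ_[p]) *
          padicRegulator Dh := by ring

/-! ### §3 Class corollary: X4♯(G-ord) ∩ I₀*, `p ≡ 3 (mod 4)`, `p ≥ 5`, rank one -/

variable {W p} in
/-- **X4♯(G-ord) ∩ `I₀*`, `p ≡ 3 (mod 4)`, `p ≥ 5`, non-CM, non-anomalous, `r_an = 1`: the LOWER half
from the two typed inputs of the odd-branch route** (`ChiBranchLowerDivisibilityOddAt W p` and, for
every (B)-datum, the Schneider rider + `BranchPAdicGrossZagierOddAt W p Dh`), all other binders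
published: Delbourgo 2002 (A)+(B) (A175, `hDel`), modularity (`hmod`, `hmodD`), GZK; the twist datum
`(V, C, f, ϖ⁻)` is DISCHARGED (`ClassX4Gord.exists_goodOrd_pStar_twist_model`, `hmodD`,
`exists_rat_mul_imaginaryPeriodRat_eq_minusPeriod`). [cite: Delbourgo2002, Theorem (A), (B) (p. 40)]
[cite: Miller2011LMS, Def. 1.1] -/
theorem ClassX4Gord.missingLowerBoundAt_rankOne_of_chiBranchLowerOdd_of_branchPAdicGrossZagierOdd
    (hDel : Delbourgo2002.mainTheorem) (hmod : hasEntireLFunction_rat)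
    (hmodD : nonempty_modularParametrizationData) (hGZK : rank_eq_analyticRank_of_analyticRank_le_one)
    (hX : ClassX4Gord W p) (he : semistabilityIndex W p = 2) (hp4 : p % 4 = 3) (hp5 : 5 ≤ p)
    (hcm : ¬ W.HasCM) (hna : ReductionNonAnomalous W p) (hr : W.analyticRank = 1)
    (hdiv : ChiBranchLowerDivisibilityOddAt W p)
    (hGZ : ∀ Dh : PAdicHeightData W p, LeadingTermClauses W p Dh →
      SchneiderConjecture Dh ∧ BranchPAdicGrossZagierOddAt W p Dh) :
    MissingLowerBoundAt W p := by
  obtain ⟨V, iV, iVm, C, hV, hC⟩ := hX.exists_goodOrd_pStar_twist_model W p he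
  haveI : NeZero (V.conductorNorm ℤ) := ⟨(V.conductorNorm_pos_holds).ne'⟩
  obtain ⟨Dm⟩ := hmodD V
  obtain ⟨ϖ, -, hϖ⟩ := exists_rat_mul_imaginaryPeriodRat_eq_minusPeriod Dm
  have hps : ((-1 : ℚ) ^ (p / 2) * (p : ℚ)) = -(p : ℚ) := by
    have hodd : Odd (p / 2) := ⟨p / 4, by omega⟩
    rw [hodd.neg_one_pow]
    ring
  have hVW : ∃ C : VariableChange ℚ, C • V.quadraticTwist (-(p : ℚ)) = W := ⟨C, by rw [← hps]; exact hC⟩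
  refine missingLowerBoundAt_of_delbourgo2002_of_cycLowerBound W p hDel hGZK hp5 hcm hX.1.2.1 hX.2
    (by rw [hr]) hna fun Dh hB ↦ ?_
  obtain ⟨hS, hGZDh⟩ := hGZ Dh hB
  exact ⟨hS, cycLowerBoundAt_of_chiBranchLowerOdd_of_branchPAdicGrossZagierOdd W p hmod hGZK hX.1.2.1
    hr hp4 V hVW hV Dm.isNewformOf ϖ hϖ hdiv hGZDh⟩

end Summit.BirchSwinnertonDyer.Rank1Residual.Additive

end
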